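import Summits.Ventures.YMGap.YM4Door.Decimation

/-!
# YM4Door / DecimationFlow — ITERATED AXIAL DECIMATION (`iterSize`, `axialIter`, cast-free), ★ THE ATTRACTOR GLUE `blockIRVia_axialIter`,
# the typed REQUESTS N-DEC `SU2.DoorDecimatesToBasin` / N-DEC′ `SU2.BasinInvariant` / `SU2.DoorFlowsToHaar` (the strong-coupling mirror of N-NP)
# and what they buy at every depth (`SU2.blockIRVia_axialIter_bare`); N-NP via a bare crossover map and the full chain `blockIRVia_decimation_chain`

HONEST FRAMING (cell `ym-beyond`, seat P2 «strong-coupling bridge», HUMAN RULING D-0035 / D-0037; g8 tree edition, 2026-08-25, split into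
≤ 400-line modules for the gate; memo `HOME/ROUTE-P2.md` v0.8, spec `HOME/ROUTE-P2-LIFT-SPEC.md` v2).  LATTICE / finite-torus bookkeeping only:
nothing here is a continuum, spectral or Clay-sense statement; nothing here moves the weak-coupling exit of Track A (uncertified); nothing
here is a part of Bałaban's theorems; NO effective action is asserted to be at any door.  NO conjecture name, NO `sorry`, NO axiom beyond
the standard three; label K = kernel bookkeeping.

Continuation of `YM4Door/Decimation.lean` (its header — HONEST FRAMING, THE QUESTION, HONEST CAVEATS (marginal directions of pure
decimation; the door edge vs the decimation core), references — is the reference; §3–§5 of the one text).  N-DEC / N-DEC′ are hypotheses of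
the closing theorems, NOT facts; for `SU(2)` lattice gauge theory in load currency they are not in print.
-/

noncomputable section

open MeasureTheory Finset Function Metric
open scoped Matrix.Norms.Frobenius
open Literature.Probability.LatticeModels Literature.Probability.LatticeModels.DobrushinMetric
open Literature.MathematicalPhysics.QuantumLattice hiding torusNorm configShift
open Literature.MathematicalPhysics.QuantumFieldTheory hiding ZdEdge
open Summit.Ventures.YMGap.RobustBall
open Summit.Ventures.YMGap.StarResolventDim (Delta gaugeR doorPoly)
open Summit.Ventures.YMGap.YM3IR.ReceiverWitness

namespace Summit.Ventures.YMGap.YM4Door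

open scoped ENNReal

/-! ## §3  ITERATED AXIAL DECIMATION and THE ATTRACTOR GLUE

`iterSize b S K = b^K·S` is written recursively so that `iterSize b S (K+1)` is `b · iterSize b S K` BY `rfl`; then the
`K`-fold decimation `axialIter b S K : GaugeConfig (b^K·S) → GaugeConfig S` composes without casts, is measurable and
Haar-exact.  ★ `blockIRVia_axialIter`: a predicate `P` of block-scale actions that is DECIMATION-INVARIANT (every `P`-action
on `b·S'` has an axial crossover image with `P` on `S'`) and implies clustering at `(A, m)` propagates block-level IR from ONE
depth to EVERY deeper depth, on every volume `S ≥ 3`, with the SAME constants — the typed form of «once the door is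
reached, the strong-coupling expansion takes over for good». -/

section Iterate

/-- `b^K · S`, recursively: `iterSize b S 0 = S`, `iterSize b S (K+1) = b · iterSize b S K` (both `rfl`). -/
def iterSize (b S : ℕ) : ℕ → ℕ
  | 0 => S
  | K + 1 => b * iterSize b S K

/-- `iterSize b S 0 = S`. -/
@[simp] theorem iterSize_zero (b S : ℕ) : iterSize b S 0 = S := rfl

/-- `iterSize b S (K+1) = b · iterSize b S K` (by `rfl`). -/
@[simp] theorem iterSize_succ (b S K : ℕ) : iterSize b S (K + 1) = b * iterSize b S K := rfl

/-- `iterSize b S K = b^K · S`. -/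
theorem iterSize_eq_pow_mul (b S : ℕ) : ∀ K, iterSize b S K = b ^ K * S
  | 0 => by simp
  | K + 1 => by rw [iterSize_succ, iterSize_eq_pow_mul b S K, pow_succ]; ring

/-- The iterated torus size is non-zero. -/
instance instNeZeroIterSize (b S : ℕ) [NeZero b] [NeZero S] (K : ℕ) : NeZero (iterSize b S K) := by
  rw [iterSize_eq_pow_mul]; infer_instance

/-- The block torus is no larger than the fine torus `b^K · S`. -/
theorem le_iterSize (b S : ℕ) [NeZero b] : ∀ K, S ≤ iterSize b S K
  | 0 => le_rfl
  | K + 1 => (le_iterSize b S K).trans (Nat.le_mul_of_pos_left _ (Nat.pos_of_ne_zero (NeZero.ne b)))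

variable (b S : ℕ) [NeZero b] [NeZero S]

/-- **`K` successive axial decimations of factor `b`** down to the block torus `S`. -/
def axialIter : ∀ K : ℕ, GaugeConfig 4 (iterSize b S K) (SUN 2) → GaugeConfig 4 S (SUN 2)
  | 0 => id
  | K + 1 => axialIter K ∘ (GaugeBlockAveraging.axial (d := 4) (G := SUN 2) b (iterSize b S K)).link

/-- Zero decimations are the identity. -/
@[simp] theorem axialIter_zero : axialIter b S 0 = id := rfl

/-- One more decimation: first the axial averaging at the finest level, then the previous `K`. -/
theorem axialIter_succ (K : ℕ) :
    axialIter b S (K + 1) = axialIter b S K ∘ (GaugeBlockAveraging.axial (d := 4) (G := SUN 2) b (iterSize b S K)).link :=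
  rfl

/-- The `K`-fold decimation is measurable. -/
theorem measurable_axialIter : ∀ K, Measurable (axialIter b S K)
  | 0 => measurable_id
  | K + 1 => (measurable_axialIter K).comp (GaugeBlockAveraging.axial b (iterSize b S K)).measurable_link

/-- **The `K`-fold decimation is Haar-exact**: it pushes product Haar of the torus `b^K·S` to product Haar of `S`. -/
theorem map_axialIter_torusLinkHaar :
    ∀ K, (torusLinkHaar 4 (SUN 2) (iterSize b S K)).map (axialIter b S K) = torusLinkHaar 4 (SUN 2) S
  | 0 => Measure.map_id
  | K + 1 => by
      show (torusLinkHaar 4 (SUN 2) (b * iterSize b S K)).map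
          (axialIter b S K ∘ (GaugeBlockAveraging.axial (d := 4) (G := SUN 2) b (iterSize b S K)).link) = _
      rw [← Measure.map_map (measurable_axialIter b S K) (GaugeBlockAveraging.axial b (iterSize b S K)).measurable_link,
        GaugeBlockAveraging.map_axial_link_torusLinkHaar, map_axialIter_torusLinkHaar K]

end Iterate

section Attractor

variable {S : ℕ} [NeZero S]

/-- **`P` is DECIMATION-INVARIANT at factor `b`**: every block-scale action with `P` on a torus `b·S'`, `S' ≥ 3`, has an
axial crossover image (`OpenDoor` §3 `IsCrossoverImage`) with `P` on `S'`.  REQUEST N-DEC′ (§4) asks it of the basin. -/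
@[folklore] def DecimationInvariant (b : ℕ) [NeZero b]
    (P : ∀ (S' : ℕ) [NeZero S'], BalabanEffectiveAction 4 S' (SUN 2) 1 → Prop) : Prop :=
  ∀ (S' : ℕ) [NeZero S'], 3 ≤ S' → ∀ x : BalabanEffectiveAction 4 (b * S') (SUN 2) 1, P (b * S') x →
    ∃ y : BalabanEffectiveAction 4 S' (SUN 2) 1, IsCrossoverImage (GaugeBlockAveraging.axial b S') x y ∧ P S' y

/-- ★ **THE ATTRACTOR GLUE.**  `P` decimation-invariant at factor `b` and `P ⇒` clustering at `(A, m)` on every volume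
`≥ 3`; a fine theory (torus `n`, bare coupling `β`) whose Gibbs form via SOME link map `Φ` onto the torus `b^K·S` has `P`
⇒ its Gibbs law blocked further by the `K` decimations clusters at block level on `S`: `BlockIRVia (axialIter b S K ∘ Φ)`.
Every depth beyond the first door membership is covered, with the SAME constants, on EVERY volume `S ≥ 3`. -/
theorem blockIRVia_axialIter {b : ℕ} [NeZero b] {P : ∀ (S' : ℕ) [NeZero S'], BalabanEffectiveAction 4 S' (SUN 2) 1 → Prop}
    (hP : DecimationInvariant b P) {A m : ℝ}
    (hcl : ∀ (S' : ℕ) [NeZero S'], 3 ≤ S' → ∀ y : BalabanEffectiveAction 4 S' (SUN 2) 1, P S' y →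
      ClustersWith y.terms y.β A m)
    (hS : 3 ≤ S) {n : ℕ} [NeZero n] (β : ℝ) :
    ∀ (K : ℕ) (Φ : GaugeConfig 4 n (SUN 2) → GaugeConfig 4 (iterSize b S K) (SUN 2)), Measurable Φ →
      ∀ x : BalabanEffectiveAction 4 (iterSize b S K) (SUN 2) 1, GibbsFormVia Φ β x → P (iterSize b S K) x →
        BlockIRVia (axialIter b S K ∘ Φ) β A m
  | 0, _, _, x, hx, hPx => ⟨x, hx, hcl S hS x hPx⟩
  | K + 1, Φ, hΦ, x, hx, hPx => by
      obtain ⟨y, hy, hPy⟩ := hP (iterSize b S K) (hS.trans (le_iterSize b S K)) x hPx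
      exact blockIRVia_axialIter hP hcl hS β K ((GaugeBlockAveraging.axial b (iterSize b S K)).link ∘ Φ)
        ((GaugeBlockAveraging.axial b (iterSize b S K)).measurable_link.comp hΦ) y
        (hx.comp hΦ (GaugeBlockAveraging.axial b (iterSize b S K)) hy) hPy

end Attractor

/-! ## §4  THE REQUESTS: N-DEC (the door decimates into the basin) and N-DEC′ (the basin is an attractor) — the
strong-coupling MIRROR of N-NP — and what they buy

Typed REQUESTS, not tree facts.  In print for finite single-spin spaces: decimation / Kadanoff maps of high-temperature
or high-field systems are Gibbsian with absolutely summable renormalised potential (Griffiths–Pearce 1979, Israel 1981,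
Kashapov 1980); uniform Dobrushin–Shlosman mixing of ALL constrained systems ⇒ the renormalised measure is Gibbsian with a
finite-norm potential computed by a convergent cluster expansion (Haller–Kennedy 1996); decimation at a spacing large
against the mixing length restores Gibbsianness and its iterates converge to the trivial fixed point (Martinelli–Olivieri
1995; Bertini–Cirillo–Olivieri 1999).  NOT in print: the compact-group, gauge-covariant, LOAD-currency version below.  The
door IS a Dobrushin regime (its rows are contraction certificates), which is these theorems' hypothesis class; the honest
gap is the constrained systems (fine links at fixed straight transporters), whose Dobrushin rows are NOT the door's rows. -/

namespace SU2

variable {S : ℕ} [NeZero S]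

/-- ★ **REQUEST N-DEC(b) — THE DOOR DECIMATES INTO THE BASIN.**  Every block-scale action at the door cell
`(β₀; ε₀, ε₁)` (effective coupling in `[0, β₀]`, terms in `InBall κ ε₀ ε₁`, `κ ≥ 1/100`) on a torus `b·S'`, `S' ≥ 3`, has
an axial crossover image AT THE BASIN `(κ'; ε₀', ε₁')` on `S'` — VOLUME-UNIFORMLY (the constants do not see `S'`).  Why it
might fail: the door's edge `β_W,eff = 1/3` is a single-link Dobrushin certificate; the constrained systems of the axial
decimation carry roughly twice the row mass at `b = 2`, so the print-level mechanism (Haller–Kennedy) reaches only a core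
of the door; at the edge it is a bet on complete analyticity of the constrained systems. -/
@[folklore] def DoorDecimatesToBasin (b : ℕ) [NeZero b] (β₀ ε₀ ε₁ κ' ε₀' ε₁' : ℝ) : Prop :=
  ∀ (S' : ℕ) [NeZero S'], 3 ≤ S' → ∀ (x : BalabanEffectiveAction 4 (b * S') (SUN 2) 1) (κ : ℝ),
    AtDoorCell x κ β₀ ε₀ ε₁ →
      ∃ y : BalabanEffectiveAction 4 S' (SUN 2) 1, IsCrossoverImage (GaugeBlockAveraging.axial b S') x y ∧ AtBasin y κ' ε₀' ε₁'

/-- ★ **REQUEST N-DEC′(b) — THE BASIN IS AN ATTRACTOR**: `AtBasin (κ'; ε₀', ε₁')` is decimation-invariant at factor `b`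
(Martinelli–Olivieri's «convergence to the trivial fixed point» in load currency, one step at a time). -/
@[folklore] def BasinInvariant (b : ℕ) [NeZero b] (κ' ε₀' ε₁' : ℝ) : Prop :=
  DecimationInvariant b fun _ _ y => AtBasin y κ' ε₀' ε₁'

/-- **The large-factor form** (Martinelli–Olivieri / Bertini–Cirillo–Olivieri shape): for every load tolerance `τ > 0`
all sufficiently coarse decimations of the door land within `τ` of the Haar point. -/
@[folklore] def DoorFlowsToHaar (β₀ ε₀ ε₁ κ' : ℝ) : Prop :=
  ∀ τ : ℝ, 0 < τ → ∃ b₀ : ℕ, ∀ (b : ℕ) [NeZero b], b₀ ≤ b → DoorDecimatesToBasin b β₀ ε₀ ε₁ κ' τ τ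

/-- ★ **WHAT N-DEC BUYS, ONE DEPTH DOWN.**  A fine theory (torus `n`, bare `β`) whose Gibbs form via `Φ` onto the torus
`b·S` is at the door cell ⇒ its law blocked once more, axially, clusters at block level on `S` at the door's constants. -/
theorem blockIRVia_axial_of_door {b : ℕ} [NeZero b] {β₀ ε₀ ε₁ κ' ε₀' ε₁' : ℝ} (hdec : DoorDecimatesToBasin b β₀ ε₀ ε₁ κ' ε₀' ε₁')
    (hS : 3 ≤ S) {n : ℕ} [NeZero n] {Φ : GaugeConfig 4 n (SUN 2) → GaugeConfig 4 (b * S) (SUN 2)} (hΦ : Measurable Φ)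
    {β : ℝ} {x : BalabanEffectiveAction 4 (b * S) (SUN 2) 1} (hx : GibbsFormVia Φ β x) {κ : ℝ}
    (hd : AtDoorCell x κ β₀ ε₀ ε₁) :
    BlockIRVia ((GaugeBlockAveraging.axial b S).link ∘ Φ) β (16 * Real.exp (1 / 50)) (1 / 100) := by
  obtain ⟨y, hy, hb⟩ := hdec S hS x κ hd
  exact (hx.comp hΦ _ hy).blockIRVia (clustersWith_of_atBasin hS y hb)

/-- ★ **WHAT N-DEC ∧ N-DEC′ BUY, EVERY DEPTH DOWN.**  Door membership of the Gibbs form at ONE depth (torus `b^{K+1}·S`)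
⇒ block-level IR after `K + 1` further decimations, for EVERY `K`, on EVERY volume `S ≥ 3`, same constants. -/
theorem blockIRVia_axialIter_of_door {b : ℕ} [NeZero b] {β₀ ε₀ ε₁ κ' ε₀' ε₁' : ℝ} (hdec : DoorDecimatesToBasin b β₀ ε₀ ε₁ κ' ε₀' ε₁')
    (hbas : BasinInvariant b κ' ε₀' ε₁') (hS : 3 ≤ S) {n : ℕ} [NeZero n] (β : ℝ) (K : ℕ)
    {Φ : GaugeConfig 4 n (SUN 2) → GaugeConfig 4 (iterSize b S (K + 1)) (SUN 2)} (hΦ : Measurable Φ)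
    {x : BalabanEffectiveAction 4 (iterSize b S (K + 1)) (SUN 2) 1} (hx : GibbsFormVia Φ β x) {κ : ℝ}
    (hd : AtDoorCell x κ β₀ ε₀ ε₁) :
    BlockIRVia (axialIter b S (K + 1) ∘ Φ) β (16 * Real.exp (1 / 50)) (1 / 100) := by
  obtain ⟨y, hy, hb⟩ := hdec (iterSize b S K) (hS.trans (le_iterSize b S K)) x κ hd
  exact blockIRVia_axialIter hbas (fun S' _ hS' y hy => clustersWith_of_atBasin hS' y hy) hS β K
    ((GaugeBlockAveraging.axial b (iterSize b S K)).link ∘ Φ)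
    ((GaugeBlockAveraging.axial b (iterSize b S K)).measurable_link.comp hΦ) y
    (hx.comp hΦ (GaugeBlockAveraging.axial b (iterSize b S K)) hy) hb

/-- ★ **THE BARE STRONG-COUPLING THEORY ALONG THE WHOLE DECIMATION TRAJECTORY.**  N-DEC ∧ N-DEC′ for the cell
`(β₀; ε₀, ε₁)` ⇒ for every bare tree coupling `β ∈ [0, β₀]` (`β_W,eff ≤ 2β₀`), every volume `S ≥ 3` and EVERY depth
`K + 1 ≥ 1`, the `SU(2)` Wilson law of the torus `b^{K+1}·S` decimated `K + 1` times clusters at block level on `S` —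
«the strong-coupling expansion takes over» at every scale below the lattice one (depth `0` is the tree door itself). -/
theorem blockIRVia_axialIter_bare {b : ℕ} [NeZero b] {β₀ ε₀ ε₁ κ' ε₀' ε₁' : ℝ} (hdec : DoorDecimatesToBasin b β₀ ε₀ ε₁ κ' ε₀' ε₁')
    (hbas : BasinInvariant b κ' ε₀' ε₁') (hε₀ : 0 ≤ ε₀) (hε₁ : 0 ≤ ε₁) (hS : 3 ≤ S) {β : ℝ} (hβ0 : 0 ≤ β)
    (hβ : β ≤ β₀) (K : ℕ) :
    BlockIRVia (axialIter b S (K + 1)) β (16 * Real.exp (1 / 50)) (1 / 100) :=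
  blockIRVia_axialIter_of_door hdec hbas hS β K measurable_id (gibbsFormVia_id_wilsonAt β)
    (⟨hβ0, hβ, le_rfl, zero_mem_clusterDomain hε₀ hε₁⟩ :
      AtDoorCell (BalabanEffectiveAction.wilsonAt (d := 4) (S := iterSize b S (K + 1)) (G := SUN 2) (c := 1) β)
        (1 / 100) β₀ ε₀ ε₁)

end SU2

/-! ## §5  N-NP FOR THE AXIAL CROSSOVER — the weak-side request re-addressed to a bare link map

`OpenDoor` §3's `CrossoverContinuousAt BK` takes a tree blocking `BK`; the `K` decimations from the scale-`g` torus are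
the bare map `axialIter b S K`.  The same request over a link map, and its glue: N-CVg-near actions at scale `g` whose
Gibbs forms come through `Φg` ⇒ block-level IR via `axialIter b S K ∘ Φg`.  Which blocking carries N-NP is thereby a
DEFINITE object: everywhere defined (no small-field condition), gauge-covariant, Haar-exact (§1, §3). -/

section CrossoverVia

variable {n S : ℕ} [NeZero n] [NeZero S]

/-- **`y` is a crossover image of `x` under the bare link map `Ψ`** (`OpenDoor` §3 `IsCrossoverImage` for `Ψ = BK.link`). -/
@[folklore] def IsCrossoverImageVia (Ψ : GaugeConfig 4 n (SUN 2) → GaugeConfig 4 S (SUN 2))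
    (x : BalabanEffectiveAction 4 n (SUN 2) 1) (y : BalabanEffectiveAction 4 S (SUN 2) 1) : Prop :=
  ((torusLinkHaar 4 (SUN 2) n).withDensity (x.density SU2.ρ2)).map Ψ =
    (torusLinkHaar 4 (SUN 2) S).withDensity (y.density SU2.ρ2)

/-- For a tree blocking, a crossover image via `BK.link` IS `IsCrossoverImage BK` (definitional). -/
theorem isCrossoverImageVia_link_iff {bK : ℕ} [NeZero bK] (BK : GaugeBlockAveraging 4 (SUN 2) bK S)
    (x : BalabanEffectiveAction 4 (bK * S) (SUN 2) 1) (y : BalabanEffectiveAction 4 S (SUN 2) 1) :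
    IsCrossoverImageVia BK.link x y ↔ IsCrossoverImage BK x y :=
  Iff.rfl

/-- Gibbs forms compose through crossover images along bare maps. -/
theorem GibbsFormVia.compVia {m : ℕ} [NeZero m] {Φ : GaugeConfig 4 m (SUN 2) → GaugeConfig 4 n (SUN 2)}
    {Ψ : GaugeConfig 4 n (SUN 2) → GaugeConfig 4 S (SUN 2)} (hΦ : Measurable Φ) (hΨ : Measurable Ψ) {β : ℝ}
    {x : BalabanEffectiveAction 4 n (SUN 2) 1} {y : BalabanEffectiveAction 4 S (SUN 2) 1}
    (hx : GibbsFormVia Φ β x) (hy : IsCrossoverImageVia Ψ x y) : GibbsFormVia (Ψ ∘ Φ) β y := by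
  unfold GibbsFormVia
  rw [← Measure.map_map hΨ hΦ, hx]
  exact hy

/-- ★ **N-NP VIA `Ψ`** — continuity at the reference of the crossover along the bare map `Ψ`, strip currency → a target
predicate `Q` of exit actions (for the door: `Q y :=` «`y` within the margins of `yref` in load currency», `OpenDoor` §3;
for the decimation chain: `Q = AtBasin`/`AtDoorCell`).  Existential in the image, as N-NP. -/
@[folklore] def CrossoverContinuousVia (Ψ : GaugeConfig 4 n (SUN 2) → GaugeConfig 4 S (SUN 2))
    (ref : BalabanEffectiveAction 4 n (SUN 2) 1) (ηc r κ η : ℝ) (Q : BalabanEffectiveAction 4 S (SUN 2) 1 → Prop) : Prop :=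
  ∀ x : BalabanEffectiveAction 4 n (SUN 2) 1, NearInStrip x ref ηc r κ η →
    ∃ y : BalabanEffectiveAction 4 S (SUN 2) 1, IsCrossoverImageVia Ψ x y ∧ Q y

/-- ★ **H-a factorised along a bare crossover map**: Gibbs form via `Φg` at scale `g` ∧ N-CVg-near the reference ∧
N-NP via `Ψ` into a clustering predicate ⇒ block-level IR via `Ψ ∘ Φg`.  With `Ψ = axialIter b S K` this is the form in
which the `K` β-free crossover steps are DECIMATIONS. -/
theorem blockIRVia_of_crossoverVia {m : ℕ} [NeZero m] {Φg : GaugeConfig 4 m (SUN 2) → GaugeConfig 4 n (SUN 2)}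
    {Ψ : GaugeConfig 4 n (SUN 2) → GaugeConfig 4 S (SUN 2)} (hΦ : Measurable Φg) (hΨ : Measurable Ψ)
    {ref : BalabanEffectiveAction 4 n (SUN 2) 1} {ηc r κ η A mm : ℝ} {Q : BalabanEffectiveAction 4 S (SUN 2) 1 → Prop}
    (hNP : CrossoverContinuousVia Ψ ref ηc r κ η Q) (hQ : ∀ y, Q y → ClustersWith y.terms y.β A mm) {β : ℝ}
    {x : BalabanEffectiveAction 4 n (SUN 2) 1} (hx : GibbsFormVia Φg β x) (hnear : NearInStrip x ref ηc r κ η) :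
    BlockIRVia (Ψ ∘ Φg) β A mm := by
  obtain ⟨y, hy, hQy⟩ := hNP x hnear
  exact (hx.compVia hΦ hΨ hy).blockIRVia (hQ y hQy)

/-- … in particular into the door cell, then down the whole decimation trajectory (§4): N-CVg ∧ N-NP(via `axialIter b S' K₁`
into the door cell) ∧ N-DEC ∧ N-DEC′ ⇒ block-level IR at every depth `≥ K₁ + 1` beyond scale `g`. -/
theorem blockIRVia_decimation_chain {b : ℕ} [NeZero b] {β₀ ε₀ ε₁ κ' ε₀' ε₁' : ℝ} (hdec : SU2.DoorDecimatesToBasin b β₀ ε₀ ε₁ κ' ε₀' ε₁')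
    (hbas : SU2.BasinInvariant b κ' ε₀' ε₁') (hS : 3 ≤ S) (K : ℕ) {m : ℕ} [NeZero m]
    {Φg : GaugeConfig 4 m (SUN 2) → GaugeConfig 4 n (SUN 2)}
    {Ψ : GaugeConfig 4 n (SUN 2) → GaugeConfig 4 (iterSize b S (K + 1)) (SUN 2)} (hΦ : Measurable Φg)
    (hΨ : Measurable Ψ) {ref : BalabanEffectiveAction 4 n (SUN 2) 1} {ηc r κ η κd : ℝ}
    (hNP : CrossoverContinuousVia Ψ ref ηc r κ η fun y => SU2.AtDoorCell y κd β₀ ε₀ ε₁) {β : ℝ}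
    {x : BalabanEffectiveAction 4 n (SUN 2) 1} (hx : GibbsFormVia Φg β x) (hnear : NearInStrip x ref ηc r κ η) :
    BlockIRVia (axialIter b S (K + 1) ∘ (Ψ ∘ Φg)) β (16 * Real.exp (1 / 50)) (1 / 100) := by
  obtain ⟨y, hy, hd⟩ := hNP x hnear
  exact SU2.blockIRVia_axialIter_of_door hdec hbas hS β K (hΨ.comp hΦ) (hx.compVia hΦ hΨ hy) hd

end CrossoverVia

end Summit.Ventures.YMGap.YM4Door

end
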